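import Mathlib.Analysis.Complex.Basic
import Literature.Probability.LatticeModels.DelaunayGraph
import HarnessLib

/-!
# Every face of the jittered square lattice carries a Delaunay diagonal — stub `stub_faceDiagonal`
# of line `SketchIdeator5R2` for crux `SquareFromVoronoiHub` (stmt-CriticalPhenomena-6434, route
# CardyFlipRusso, sub-problem CardyFormulaZ2)

For a jitter field `ξ : ℤ × ℤ → ℂ` with `‖ξ v‖ ≤ a`, `0 ≤ a ≤ 1/20`, and the jittered sites
`S = {u.1 + u.2 I + ξ u | u ∈ ℤ²}`, every lattice face with jittered corners `A` (SW), `B` (SE),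
`C` (NE), `D` (NW) has at least one Delaunay diagonal: `{A, C}` or `{B, D}` is a Delaunay pair of `S`
(closed empty circumscribed ball rule, `Literature.Probability.LatticeModels.IsDelaunayPair`).

Proof (planar algebra only).  The perpendicular bisectors of `AC` and `BD` meet at a point `c`:
a `2 × 2` linear system whose matrix has rows `C - A ≈ (1, 1)` and `D - B ≈ (-1, 1)`
(determinant `≥ 81/50`) and right-hand side of size `≤ 11/100`, solved by Cramer's rule; its
solution lies within `3/10` of the lattice face centre `m` (`center_real`, `center_complex`).  With
`dist A c = dist C c` and `dist B c = dist D c`, the smaller of the two radii gives a closed ball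
through the endpoints of one diagonal with the other two corners outside or on it; every other
site `u.1 + u.2 I + ξ u` is at distance `≥ 3/2 - a - 3/10` from `c` (the lattice point is at distance
`≥ 3/2` from `m`, `far_offset`), while the radius is `≤ 3/4 + a + 3/10` (`‖(±1/2, ±1/2)‖ ≤ 3/4`), and
`3/4 + a + 3/10 ≤ 3/2 - a - 3/10` for `a ≤ 1/20`.  No named facts are used.
-/

noncomputable section

open Literature.Probability.LatticeModels (IsDelaunayPair)

namespace Summit.CriticalPhenomena.CardyFormulaZ2.Cruxes.SquareFromVoronoiHub.ProductLeg

namespace stub_faceDiagonalAux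

/-- **Cramer's rule** for a real `2 × 2` system with non-zero determinant: a solution `(x, y)` of
`M₁₁ x + M₁₂ y = b₁`, `M₂₁ x + M₂₂ y = b₂`, together with the two Cramer identities
`det • x = M₂₂ b₁ - M₁₂ b₂`, `det • y = M₁₁ b₂ - M₂₁ b₁`. [folklore] -/
theorem cramer_two (M₁₁ M₁₂ M₂₁ M₂₂ b₁ b₂ : ℝ) (hdet : M₁₁ * M₂₂ - M₁₂ * M₂₁ ≠ 0) :
    ∃ x y : ℝ, M₁₁ * x + M₁₂ * y = b₁ ∧ M₂₁ * x + M₂₂ * y = b₂ ∧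
      (M₁₁ * M₂₂ - M₁₂ * M₂₁) * x = M₂₂ * b₁ - M₁₂ * b₂ ∧
      (M₁₁ * M₂₂ - M₁₂ * M₂₁) * y = M₁₁ * b₂ - M₂₁ * b₁ := by
  refine ⟨(M₂₂ * b₁ - M₁₂ * b₂) / (M₁₁ * M₂₂ - M₁₂ * M₂₁),
    (M₁₁ * b₂ - M₂₁ * b₁) / (M₁₁ * M₂₂ - M₁₂ * M₂₁), ?_, ?_,
    mul_div_cancel₀ _ hdet, mul_div_cancel₀ _ hdet⟩
  · rw [mul_div_assoc', mul_div_assoc', ← add_div, div_eq_iff hdet]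
    ring
  · rw [mul_div_assoc', mul_div_assoc', ← add_div, div_eq_iff hdet]
    ring

/-- Lower bound `81/50` for the determinant of a `2 × 2` matrix whose entries are within `1/10` of
those of `[[1, 1], [-1, 1]]` (from below, where it matters). [folklore] -/
theorem det_lower {M₁₁ M₁₂ M₂₁ M₂₂ : ℝ} (h₁₁ : 9 / 10 ≤ M₁₁) (h₁₂ : 9 / 10 ≤ M₁₂)
    (h₂₁ : 9 / 10 ≤ -M₂₁) (h₂₂ : 9 / 10 ≤ M₂₂) : 81 / 50 ≤ M₁₁ * M₂₂ - M₁₂ * M₂₁ := by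
  nlinarith [mul_nonneg (sub_nonneg.2 h₁₁) (sub_nonneg.2 h₂₂),
    mul_nonneg (sub_nonneg.2 h₁₂) (sub_nonneg.2 h₂₁)]

/-- **Size of the Cramer solution.**  If the matrix is entrywise within `1/10` of `[[1, 1], [-1, 1]]`
and the right-hand side has entries of size `≤ 11/100`, the solution `(x, y)` of the `2 × 2` system
satisfies `|x|, |y| ≤ 1/5`, hence `x² + y² ≤ (3/10)²`. [folklore] -/
theorem solution_bound {M₁₁ M₁₂ M₂₁ M₂₂ b₁ b₂ x y : ℝ}
    (hx : (M₁₁ * M₂₂ - M₁₂ * M₂₁) * x = M₂₂ * b₁ - M₁₂ * b₂)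
    (hy : (M₁₁ * M₂₂ - M₁₂ * M₂₁) * y = M₁₁ * b₂ - M₂₁ * b₁)
    (h₁₁ : 9 / 10 ≤ M₁₁ ∧ M₁₁ ≤ 11 / 10) (h₁₂ : 9 / 10 ≤ M₁₂ ∧ M₁₂ ≤ 11 / 10)
    (h₂₁ : 9 / 10 ≤ -M₂₁ ∧ -M₂₁ ≤ 11 / 10) (h₂₂ : 9 / 10 ≤ M₂₂ ∧ M₂₂ ≤ 11 / 10)
    (hb₁ : -(11 / 100) ≤ b₁ ∧ b₁ ≤ 11 / 100) (hb₂ : -(11 / 100) ≤ b₂ ∧ b₂ ≤ 11 / 100) :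
    x ^ 2 + y ^ 2 ≤ (3 / 10) ^ 2 := by
  have hdet := det_lower h₁₁.1 h₁₂.1 h₂₁.1 h₂₂.1
  have hdet0 : (0 : ℝ) < M₁₁ * M₂₂ - M₁₂ * M₂₁ := by linarith
  have p1 : 0 ≤ M₂₂ * (11 / 100 - b₁) := mul_nonneg (by linarith) (by linarith)
  have p2 : 0 ≤ M₁₂ * (11 / 100 + b₂) := mul_nonneg (by linarith) (by linarith)
  have p3 : 0 ≤ M₂₂ * (11 / 100 + b₁) := mul_nonneg (by linarith) (by linarith)
  have p4 : 0 ≤ M₁₂ * (11 / 100 - b₂) := mul_nonneg (by linarith) (by linarith)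
  have p5 : 0 ≤ M₁₁ * (11 / 100 - b₂) := mul_nonneg (by linarith) (by linarith)
  have p6 : 0 ≤ -M₂₁ * (11 / 100 - b₁) := mul_nonneg (by linarith) (by linarith)
  have p7 : 0 ≤ M₁₁ * (11 / 100 + b₂) := mul_nonneg (by linarith) (by linarith)
  have p8 : 0 ≤ -M₂₁ * (11 / 100 + b₁) := mul_nonneg (by linarith) (by linarith)
  have hx1 : x ≤ 1 / 5 := by
    refine le_of_mul_le_mul_left ?_ hdet0
    rw [hx]
    linarith
  have hx2 : -(1 / 5) ≤ x := by
    refine le_of_mul_le_mul_left ?_ hdet0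
    rw [hx]
    linarith
  have hy1 : y ≤ 1 / 5 := by
    refine le_of_mul_le_mul_left ?_ hdet0
    rw [hy]
    linarith
  have hy2 : -(1 / 5) ≤ y := by
    refine le_of_mul_le_mul_left ?_ hdet0
    rw [hy]
    linarith
  nlinarith [mul_nonneg (sub_nonneg.2 hx1) (show (0 : ℝ) ≤ 1 / 5 + x by linarith),
    mul_nonneg (sub_nonneg.2 hy1) (show (0 : ℝ) ≤ 1 / 5 + y by linarith)]

/-- **The centre in coordinates.**  For corner offsets `α, β, γ, δ` (SW, SE, NE, NW) of Euclidean
size `≤ a ≤ 1/20` there is a point `(x, y)` with `x² + y² ≤ (3/10)²` equidistant from the SW corner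
`(-1/2, -1/2) + α` and the NE corner `(1/2, 1/2) + γ`, and equidistant from the SE corner
`(1/2, -1/2) + β` and the NW corner `(-1/2, 1/2) + δ` (intersection of the two perpendicular
bisectors, by Cramer's rule). [folklore] -/
theorem center_real {a α₁ α₂ β₁ β₂ γ₁ γ₂ δ₁ δ₂ : ℝ} (ha0 : 0 ≤ a) (ha : a ≤ 1 / 20)
    (hα : α₁ ^ 2 + α₂ ^ 2 ≤ a ^ 2) (hβ : β₁ ^ 2 + β₂ ^ 2 ≤ a ^ 2)
    (hγ : γ₁ ^ 2 + γ₂ ^ 2 ≤ a ^ 2) (hδ : δ₁ ^ 2 + δ₂ ^ 2 ≤ a ^ 2) :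
    ∃ x y : ℝ,
      (-1 / 2 + α₁ - x) ^ 2 + (-1 / 2 + α₂ - y) ^ 2 =
          (1 / 2 + γ₁ - x) ^ 2 + (1 / 2 + γ₂ - y) ^ 2 ∧
        (1 / 2 + β₁ - x) ^ 2 + (-1 / 2 + β₂ - y) ^ 2 =
          (-1 / 2 + δ₁ - x) ^ 2 + (1 / 2 + δ₂ - y) ^ 2 ∧
        x ^ 2 + y ^ 2 ≤ (3 / 10) ^ 2 := by
  have bnd : ∀ s t : ℝ, s ^ 2 + t ^ 2 ≤ a ^ 2 → (-a ≤ s ∧ s ≤ a) ∧ (-a ≤ t ∧ t ≤ a) :=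
    fun s t h =>
    ⟨abs_le_of_sq_le_sq' (by nlinarith [sq_nonneg t]) ha0,
      abs_le_of_sq_le_sq' (by nlinarith [sq_nonneg s]) ha0⟩
  obtain ⟨⟨hα₁, hα₁'⟩, hα₂, hα₂'⟩ := bnd α₁ α₂ hα
  obtain ⟨⟨hβ₁, hβ₁'⟩, hβ₂, hβ₂'⟩ := bnd β₁ β₂ hβ
  obtain ⟨⟨hγ₁, hγ₁'⟩, hγ₂, hγ₂'⟩ := bnd γ₁ γ₂ hγ
  obtain ⟨⟨hδ₁, hδ₁'⟩, hδ₂, hδ₂'⟩ := bnd δ₁ δ₂ hδ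
  have ha2 : a ^ 2 ≤ 1 / 400 := by nlinarith
  -- the linear system for the centre: rows `C - A` and `D - B`, entries within `2a ≤ 1/10` of `±1`
  have h₁₁ : 9 / 10 ≤ 1 + γ₁ - α₁ ∧ 1 + γ₁ - α₁ ≤ 11 / 10 := ⟨by linarith, by linarith⟩
  have h₁₂ : 9 / 10 ≤ 1 + γ₂ - α₂ ∧ 1 + γ₂ - α₂ ≤ 11 / 10 := ⟨by linarith, by linarith⟩
  have h₂₁ : 9 / 10 ≤ -(-1 + δ₁ - β₁) ∧ -(-1 + δ₁ - β₁) ≤ 11 / 10 := ⟨by linarith, by linarith⟩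
  have h₂₂ : 9 / 10 ≤ 1 + δ₂ - β₂ ∧ 1 + δ₂ - β₂ ≤ 11 / 10 := ⟨by linarith, by linarith⟩
  -- right-hand sides `(|C|² - |A|²)/2`, `(|D|² - |B|²)/2` of size `≤ 2a + a²/2 ≤ 11/100`
  have hb₁ : -(11 / 100) ≤
        ((1 / 2 + γ₁) ^ 2 + (1 / 2 + γ₂) ^ 2 - (-1 / 2 + α₁) ^ 2 - (-1 / 2 + α₂) ^ 2) / 2 ∧
      ((1 / 2 + γ₁) ^ 2 + (1 / 2 + γ₂) ^ 2 - (-1 / 2 + α₁) ^ 2 - (-1 / 2 + α₂) ^ 2) / 2 ≤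
        11 / 100 :=
    ⟨by linarith [sq_nonneg α₁, sq_nonneg α₂, sq_nonneg γ₁, sq_nonneg γ₂],
      by linarith [sq_nonneg α₁, sq_nonneg α₂, sq_nonneg γ₁, sq_nonneg γ₂]⟩
  have hb₂ : -(11 / 100) ≤
        ((-1 / 2 + δ₁) ^ 2 + (1 / 2 + δ₂) ^ 2 - (1 / 2 + β₁) ^ 2 - (-1 / 2 + β₂) ^ 2) / 2 ∧
      ((-1 / 2 + δ₁) ^ 2 + (1 / 2 + δ₂) ^ 2 - (1 / 2 + β₁) ^ 2 - (-1 / 2 + β₂) ^ 2) / 2 ≤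
        11 / 100 :=
    ⟨by linarith [sq_nonneg β₁, sq_nonneg β₂, sq_nonneg δ₁, sq_nonneg δ₂],
      by linarith [sq_nonneg β₁, sq_nonneg β₂, sq_nonneg δ₁, sq_nonneg δ₂]⟩
  have hdet := det_lower h₁₁.1 h₁₂.1 h₂₁.1 h₂₂.1
  obtain ⟨x, y, h1, h2, h3, h4⟩ := cramer_two (1 + γ₁ - α₁) (1 + γ₂ - α₂) (-1 + δ₁ - β₁)
    (1 + δ₂ - β₂)
    (((1 / 2 + γ₁) ^ 2 + (1 / 2 + γ₂) ^ 2 - (-1 / 2 + α₁) ^ 2 - (-1 / 2 + α₂) ^ 2) / 2)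
    (((-1 / 2 + δ₁) ^ 2 + (1 / 2 + δ₂) ^ 2 - (1 / 2 + β₁) ^ 2 - (-1 / 2 + β₂) ^ 2) / 2)
    (ne_of_gt (lt_of_lt_of_le (by norm_num) hdet))
  exact ⟨x, y, by linear_combination 2 * h1, by linear_combination 2 * h2,
    solution_bound h3 h4 h₁₁ h₁₂ h₂₁ h₂₂ hb₁ hb₂⟩

/-- **The centre, complex form.**  For four points `A, B, C, D` within `a ≤ 1/20` of the corners
`m + (∓1/2, ∓1/2)` of a unit square centred at `m` (SW, SE, NE, NW), there is a point `c` with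
`dist A c = dist C c`, `dist B c = dist D c` and `‖c - m‖ ≤ 3/10`. [folklore] -/
theorem center_complex {a : ℝ} (ha0 : 0 ≤ a) (ha : a ≤ 1 / 20) {A B C D m eA eB eC eD : ℂ}
    (hA : A = m + ⟨-1 / 2, -1 / 2⟩ + eA) (hB : B = m + ⟨1 / 2, -1 / 2⟩ + eB)
    (hC : C = m + ⟨1 / 2, 1 / 2⟩ + eC) (hD : D = m + ⟨-1 / 2, 1 / 2⟩ + eD)
    (heA : ‖eA‖ ≤ a) (heB : ‖eB‖ ≤ a) (heC : ‖eC‖ ≤ a) (heD : ‖eD‖ ≤ a) :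
    ∃ c : ℂ, dist A c = dist C c ∧ dist B c = dist D c ∧ ‖c - m‖ ≤ 3 / 10 := by
  have hsq : ∀ e : ℂ, ‖e‖ ≤ a → e.re ^ 2 + e.im ^ 2 ≤ a ^ 2 := fun e he =>
    calc e.re ^ 2 + e.im ^ 2 = ‖e‖ ^ 2 := by rw [Complex.sq_norm, Complex.normSq_apply]; ring
      _ ≤ a ^ 2 := pow_le_pow_left₀ (norm_nonneg e) he 2
  obtain ⟨x, y, h1, h2, hb⟩ :=
    center_real ha0 ha (hsq eA heA) (hsq eB heB) (hsq eC heC) (hsq eD heD)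
  have key : ∀ (e : ℂ) (s t : ℝ),
      dist (m + ⟨s, t⟩ + e) (m + ⟨x, y⟩) = √((s + e.re - x) ^ 2 + (t + e.im - y) ^ 2) := by
    intro e s t
    rw [Complex.dist_eq_re_im]
    congr 1
    simp only [Complex.add_re, Complex.add_im]
    ring
  refine ⟨m + ⟨x, y⟩, ?_, ?_, ?_⟩
  · rw [hA, hC, key, key]
    exact congrArg Real.sqrt h1
  · rw [hB, hD, key, key]
    exact congrArg Real.sqrt h2
  · rw [show m + (⟨x, y⟩ : ℂ) - m = ⟨x, y⟩ by ring]
    refine (abs_le_of_sq_le_sq' ?_ (by norm_num)).2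
    rw [Complex.sq_norm, Complex.normSq_mk]
    nlinarith [hb]

/-- **Lattice separation around a face.**  For integers `(k₁, k₂) ∉ {0, 1}²`:
`(k₁ - 1/2)² + (k₂ - 1/2)² ≥ 9/4` (one offset has `|kᵢ - 1/2| ≥ 3/2`). [folklore] -/
theorem far_offset {k₁ k₂ : ℤ} (h : ¬((k₁ = 0 ∨ k₁ = 1) ∧ (k₂ = 0 ∨ k₂ = 1))) :
    (9 : ℝ) / 4 ≤ ((k₁ : ℝ) - 1 / 2) ^ 2 + ((k₂ : ℝ) - 1 / 2) ^ 2 := by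
  have hk : k₁ ≤ -1 ∨ 2 ≤ k₁ ∨ k₂ ≤ -1 ∨ 2 ≤ k₂ := by omega
  rcases hk with hk | hk | hk | hk
  · have hk' : (k₁ : ℝ) ≤ -1 := by exact_mod_cast hk
    nlinarith [sq_nonneg ((k₂ : ℝ) - 1 / 2),
      mul_nonneg (show (0 : ℝ) ≤ -1 - k₁ by linarith) (show (0 : ℝ) ≤ 2 - k₁ by linarith)]
  · have hk' : (2 : ℝ) ≤ k₁ := by exact_mod_cast hk
    nlinarith [sq_nonneg ((k₂ : ℝ) - 1 / 2),
      mul_nonneg (show (0 : ℝ) ≤ k₁ - 2 by linarith) (show (0 : ℝ) ≤ k₁ + 1 by linarith)]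
  · have hk' : (k₂ : ℝ) ≤ -1 := by exact_mod_cast hk
    nlinarith [sq_nonneg ((k₁ : ℝ) - 1 / 2),
      mul_nonneg (show (0 : ℝ) ≤ -1 - k₂ by linarith) (show (0 : ℝ) ≤ 2 - k₂ by linarith)]
  · have hk' : (2 : ℝ) ≤ k₂ := by exact_mod_cast hk
    nlinarith [sq_nonneg ((k₁ : ℝ) - 1 / 2),
      mul_nonneg (show (0 : ℝ) ≤ k₂ - 2 by linarith) (show (0 : ℝ) ≤ k₂ + 1 by linarith)]

/-- **Radius bound.**  A point `X = m + (s, t) + e` with `s² = t² = 1/4`, `‖e‖ ≤ a` is at distance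
`≤ 3/4 + a + 3/10` from any `c` with `‖c - m‖ ≤ 3/10` (`‖(s, t)‖ = √(1/2) ≤ 3/4`). [folklore] -/
theorem dist_le_of_decomp {X m e c : ℂ} {a s t : ℝ} (hX : X = m + ⟨s, t⟩ + e)
    (hs : s ^ 2 = 1 / 4) (ht : t ^ 2 = 1 / 4) (he : ‖e‖ ≤ a) (hc : ‖c - m‖ ≤ 3 / 10) :
    dist X c ≤ 3 / 4 + a + 3 / 10 := by
  have hw : ‖(⟨s, t⟩ : ℂ)‖ ≤ 3 / 4 := by
    refine (abs_le_of_sq_le_sq' ?_ (by norm_num)).2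
    rw [Complex.sq_norm, Complex.normSq_mk]
    nlinarith
  rw [dist_eq_norm, hX, show m + ⟨s, t⟩ + e - c = ⟨s, t⟩ + e - (c - m) by ring]
  exact (norm_sub_le _ _).trans (by linarith [norm_add_le (⟨s, t⟩ : ℂ) e])

/-- **Clearance bound.**  A point `X = m + q + e` with `‖q‖ ≥ 3/2`, `‖e‖ ≤ a` is at distance
`≥ 3/2 - a - 3/10` from any `c` with `‖c - m‖ ≤ 3/10`. [folklore] -/
theorem le_dist_of_decomp {X m q e c : ℂ} {a : ℝ} (hX : X = m + q + e) (hq : 3 / 2 ≤ ‖q‖)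
    (he : ‖e‖ ≤ a) (hc : ‖c - m‖ ≤ 3 / 10) : 3 / 2 - a - 3 / 10 ≤ dist X c := by
  rw [dist_eq_norm, hX]
  have h1 : ‖q‖ ≤ ‖m + q + e - c - e‖ + ‖c - m‖ := by
    calc ‖q‖ = ‖(m + q + e - c - e) + (c - m)‖ := by congr 1; ring
      _ ≤ _ := norm_add_le _ _
  linarith [norm_sub_le (m + q + e - c) e]

/-- **Workhorse** (the stub with the site map `P u = u.1 + u.2 I + ξ u` abstracted and the base
corner `v = (v₁, v₂)` destructured): one of the two diagonals of the face is a Delaunay pair of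
`Set.range P`.  Witness: the intersection `c` of the perpendicular bisectors of the two jittered
diagonals and the smaller of the two radii. [folklore] -/
theorem faceDiagonal_of {a : ℝ} {ξ : ℤ × ℤ → ℂ} (ha0 : 0 ≤ a) (ha : a ≤ 1 / 20)
    (hξ : ∀ v, ‖ξ v‖ ≤ a) (P : ℤ × ℤ → ℂ)
    (hP : ∀ u, P u = ((u.1 : ℂ) + (u.2 : ℂ) * Complex.I) + ξ u) (v₁ v₂ : ℤ) :
    IsDelaunayPair (Set.range P) (P (v₁, v₂)) (P (v₁ + 1, v₂ + 1)) ∨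
      IsDelaunayPair (Set.range P) (P (v₁ + 1, v₂)) (P (v₁, v₂ + 1)) := by
  -- the lattice face centre `m`; every site decomposes as `m + (lattice offset) + jitter`
  obtain ⟨m, hm⟩ : ∃ m : ℂ, m = ⟨(v₁ : ℝ) + 1 / 2, (v₂ : ℝ) + 1 / 2⟩ := ⟨_, rfl⟩
  have hsite : ∀ (u₁ u₂ : ℤ) (s t : ℝ), (u₁ : ℝ) = v₁ + 1 / 2 + s → (u₂ : ℝ) = v₂ + 1 / 2 + t →
      P (u₁, u₂) = m + ⟨s, t⟩ + ξ (u₁, u₂) := by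
    intro u₁ u₂ s t hs ht
    rw [hP, hm]
    apply Complex.ext
    · simp only [Complex.add_re, Complex.mul_re, Complex.intCast_re, Complex.intCast_im,
        Complex.I_re, Complex.I_im, hs]
      ring
    · simp only [Complex.add_im, Complex.mul_im, Complex.intCast_re, Complex.intCast_im,
        Complex.I_re, Complex.I_im, ht]
      ring
  have hA : P (v₁, v₂) = m + ⟨-1 / 2, -1 / 2⟩ + ξ (v₁, v₂) :=
    hsite _ _ _ _ (by ring) (by ring)
  have hB : P (v₁ + 1, v₂) = m + ⟨1 / 2, -1 / 2⟩ + ξ (v₁ + 1, v₂) :=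
    hsite _ _ _ _ (by push_cast; ring) (by ring)
  have hC : P (v₁ + 1, v₂ + 1) = m + ⟨1 / 2, 1 / 2⟩ + ξ (v₁ + 1, v₂ + 1) :=
    hsite _ _ _ _ (by push_cast; ring) (by push_cast; ring)
  have hD : P (v₁, v₂ + 1) = m + ⟨-1 / 2, 1 / 2⟩ + ξ (v₁, v₂ + 1) :=
    hsite _ _ _ _ (by ring) (by push_cast; ring)
  -- the common point of the two perpendicular bisectors
  obtain ⟨c, hAC, hBD, hcm⟩ := center_complex ha0 ha hA hB hC hD (hξ _) (hξ _) (hξ _) (hξ _)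
  -- the two candidate radii are `≤ 3/4 + a + 3/10`
  have hrA : dist (P (v₁, v₂)) c ≤ 3 / 4 + a + 3 / 10 :=
    dist_le_of_decomp hA (by norm_num) (by norm_num) (hξ _) hcm
  have hrB : dist (P (v₁ + 1, v₂)) c ≤ 3 / 4 + a + 3 / 10 :=
    dist_le_of_decomp hB (by norm_num) (by norm_num) (hξ _) hcm
  -- every site off the face is at distance `≥ 3/2 - a - 3/10 ≥ 3/4 + a + 3/10` from `c`
  have hfar : ∀ u₁ u₂ : ℤ, (u₁, u₂) ≠ (v₁, v₂) → (u₁, u₂) ≠ (v₁ + 1, v₂) →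
      (u₁, u₂) ≠ (v₁ + 1, v₂ + 1) → (u₁, u₂) ≠ (v₁, v₂ + 1) →
      3 / 4 + a + 3 / 10 ≤ dist (P (u₁, u₂)) c := by
    intro u₁ u₂ h1 h2 h3 h4
    simp only [ne_eq, Prod.mk.injEq] at h1 h2 h3 h4
    have hk : ¬((u₁ - v₁ = 0 ∨ u₁ - v₁ = 1) ∧ (u₂ - v₂ = 0 ∨ u₂ - v₂ = 1)) := by omega
    have h9 := far_offset hk
    push_cast at h9
    have hPu : P (u₁, u₂) = m + ⟨(u₁ : ℝ) - v₁ - 1 / 2, (u₂ : ℝ) - v₂ - 1 / 2⟩ + ξ (u₁, u₂) :=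
      hsite _ _ _ _ (by ring) (by ring)
    have hq2 : (3 / 2 : ℝ) ^ 2 ≤ ‖(⟨(u₁ : ℝ) - v₁ - 1 / 2, (u₂ : ℝ) - v₂ - 1 / 2⟩ : ℂ)‖ ^ 2 := by
      rw [Complex.sq_norm, Complex.normSq_mk]
      nlinarith [h9]
    have hq : 3 / 2 ≤ ‖(⟨(u₁ : ℝ) - v₁ - 1 / 2, (u₂ : ℝ) - v₂ - 1 / 2⟩ : ℂ)‖ :=
      le_of_pow_le_pow_left₀ two_ne_zero (norm_nonneg _) hq2
    have hge := le_dist_of_decomp hPu hq (hξ _) hcm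
    linarith
  -- dichotomy on the two radii
  rcases le_or_gt (dist (P (v₁, v₂)) c) (dist (P (v₁ + 1, v₂)) c) with h | h
  · refine Or.inl ⟨c, dist (P (v₁, v₂)) c, rfl, hAC.symm, ?_⟩
    rintro _ ⟨⟨u₁, u₂⟩, rfl⟩
    by_cases h1 : (u₁, u₂) = (v₁, v₂)
    · exact le_of_eq (by rw [h1])
    by_cases h2 : (u₁, u₂) = (v₁ + 1, v₂)
    · rw [h2]
      exact h
    by_cases h3 : (u₁, u₂) = (v₁ + 1, v₂ + 1)
    · rw [h3]
      exact hAC.le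
    by_cases h4 : (u₁, u₂) = (v₁, v₂ + 1)
    · rw [h4]
      exact h.trans_eq hBD
    exact hrA.trans (hfar u₁ u₂ h1 h2 h3 h4)
  · refine Or.inr ⟨c, dist (P (v₁ + 1, v₂)) c, rfl, hBD.symm, ?_⟩
    rintro _ ⟨⟨u₁, u₂⟩, rfl⟩
    by_cases h1 : (u₁, u₂) = (v₁, v₂)
    · rw [h1]
      exact h.le
    by_cases h2 : (u₁, u₂) = (v₁ + 1, v₂)
    · exact le_of_eq (by rw [h2])
    by_cases h3 : (u₁, u₂) = (v₁ + 1, v₂ + 1)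
    · rw [h3]
      exact h.le.trans_eq hAC
    by_cases h4 : (u₁, u₂) = (v₁, v₂ + 1)
    · rw [h4]
      exact hBD.le
    exact hrB.trans (hfar u₁ u₂ h1 h2 h3 h4)

end stub_faceDiagonalAux

open stub_faceDiagonalAux in
/-- **stub_faceDiagonal** (endpoint geometry (iii) of line `SketchIdeator5R2`): for jitter
amplitude `0 ≤ a ≤ 1/20` and jitters `‖ξ v‖ ≤ a`, in every face of the jittered square lattice
`{u.1 + u.2 I + ξ u}` — corners `A = p v` (SW), `B = p (v.1+1, v.2)` (SE), `C = p (v.1+1, v.2+1)`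
(NE), `D = p (v.1, v.2+1)` (NW) — at least one of the diagonals `{A, C}`, `{B, D}` is a Delaunay
pair: the perpendicular bisectors of `AC` and `BD` meet at a point `c` within `3/10` of the face
centre, and the closed ball about `c` through the endpoints of the diagonal with the smaller
radius (`≤ 3/4 + a + 3/10`) has the two other corners and every further site
(at distance `≥ 3/2 - a - 3/10`) outside or on its boundary. [folklore] -/
theorem stub_faceDiagonal :
    ∀ (a : ℝ) (ξ : ℤ × ℤ → ℂ), 0 ≤ a → a ≤ 1 / 20 → (∀ v, ‖ξ v‖ ≤ a) →
      ∀ v : ℤ × ℤ,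
        IsDelaunayPair (Set.range fun u : ℤ × ℤ => ((u.1 : ℂ) + (u.2 : ℂ) * Complex.I) + ξ u)
            (((v.1 : ℂ) + (v.2 : ℂ) * Complex.I) + ξ v)
            ((((v.1 + 1 : ℤ) : ℂ) + ((v.2 + 1 : ℤ) : ℂ) * Complex.I) + ξ (v.1 + 1, v.2 + 1)) ∨
          IsDelaunayPair (Set.range fun u : ℤ × ℤ => ((u.1 : ℂ) + (u.2 : ℂ) * Complex.I) + ξ u)
            ((((v.1 + 1 : ℤ) : ℂ) + (v.2 : ℂ) * Complex.I) + ξ (v.1 + 1, v.2))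
            (((v.1 : ℂ) + ((v.2 + 1 : ℤ) : ℂ) * Complex.I) + ξ (v.1, v.2 + 1)) := by
  intro a ξ ha0 ha hξ v
  obtain ⟨v₁, v₂⟩ := v
  exact faceDiagonal_of ha0 ha hξ (fun u : ℤ × ℤ => ((u.1 : ℂ) + (u.2 : ℂ) * Complex.I) + ξ u)
    (fun _ => rfl) v₁ v₂

end Summit.CriticalPhenomena.CardyFormulaZ2.Cruxes.SquareFromVoronoiHub.ProductLeg

end
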